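import Summits.QuantumFields.YangMills.Theorems.BalabanUVNodesN07ChartLinFlatLieTok
import Summits.QuantumFields.YangMills.Theorems.BalabanUVNodesN07SectCRegimeOfRecordSmall
import Summits.QuantumFields.YangMills.Theorems.BalabanUVNodesN07SchemeTokOfRecordTwoSmall
import HarnessLib

/-!
# N07 at the record, `N = 2` — ASSEMBLY: (rng) ∧ (star_mem)'s AVERAGE CONJUNCT `Ū^k(𝔖♭.chartCfgLin T♭ V) = V` FOR THE FRAME-FREE (47)-CARRYING CHART FROM THE
# STANDARD ROW LIST OF THE (47)-FREE CHART (g27 ✓`lieTokAt_bgSchemeOfRecord_two`), AND WITH EVERY SECT. C ROW DISCHARGED IN THE SMALL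

Cell `pub-ymgap`, seat `pub-ymgap-dag-n07-w3` (g28, WIDTH SEAT 3 on N07 [B11]); helper file keyed `--supports stmt-QuantumFields-27238 --as helper` (K0ᴬ road);
count-neutral.  INTENT-17 of the seat — the last link of the CURE-SPEC chain LOCATED-g28-2∕3 → (A4) → ✓p831187∕✓p831330∕✓p831331∕(INTENT-16).

## What is here (`N = 2`, `𝔖♭ := bgSchemeOfRecord F 2 K k Ω U₀ dom levB G′ Δ2 a hposπ hpos♭ hQ ε_C B₀ C₄ a₃ j a𝔄 ε₄`, slot `T♭ := fun _ => T47 H₁♭ C^{sl} ε_C` inline)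

* §1 ★★★★ `iter_chartCfgLinFlat_eq_two` — AT ONE FIELD `V`: the guard of `U₀` below `k`; the data rows (`G′`, `Δ⁽²⁾` real and commuting with the scalar part); Sect. C's rows
  (`Regime H₁♭ 0 C^{sl} …`, `Prop4Hyp`, `hCreal`, `hCtr`, `a₃ ≤ a_C`); Prop. 6's regime AT `V` (`Regime 𝔊 0 W B₀ 0 C₄ a₃ j a𝔄 ε₄`, `‖J‖ ≤ j`, `‖𝔄♭V‖ < a𝔄`); the slot-(c) slice token
  `FrakGSliceTok`; the (20)-smallness `‖V(c)·(Ū^kU₀)(c)⋆ − 1‖ ≤ 1∕4`; the guard for the chart field and the A-side log-disc row ⟹ **`Averaging.iter (avOfRecord F 2 K) k (𝔖♭.chartCfgLin T♭ V) = V`**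
  (✓`iter_chartCfgLinFlat_eq_of_lieTokAt` fed by g27's ✓`lieTokAt_bgSchemeOfRecord_two`; `ε₄ + a𝔄 ≤ a₃` is `Regime.dom`).
* §1 ★★★★ `exists_radius_iter_chartCfgLinFlat_eq_two` — the same with the chart-field guard and the A-side log-disc row DISCHARGED (one `ρ > 0` from the background and the
  Sect. C data; all scheme data `dom, G′, Δ⁽²⁾, hposπ` and parameters with `ε₄ + a𝔄 ≤ ρ` quantified AFTER `ρ`).
* §2 ★★★★★ `exists_iter_chartCfgLinFlat_eq_two_smallRadii` — EVERY SECT. C ROW DISCHARGED TOO: there is `t₀ > 0` (background, level data, slot-(a)∕(b) positivity) such that for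
  every Sect. C radius `0 < ε_C ≤ t₀` (with `a_C := ε_C`) there is `ρ > 0` such that, for all scheme data and parameters with `ε₄ + a𝔄 ≤ ρ`, `a₃ ≤ ε_C`, the data rows,
  Prop. 6's regime at `V`, `FrakGSliceTok`, the (20)-smallness `≤ 1∕4` and `‖𝔄♭V‖ < a𝔄`: `Ū^k(𝔖♭.chartCfgLin T♭ V) = V` (this lineage's ✓`exists_sectCRegime_ofRecord` +
  ✓`exists_radius_cslRows`).

## Honest labels

Assembly of landed theorems; EVERY estimate of Bałaban stays DISPLAYED exactly as in g27's ✓`…N07LieTokAtOfRecordTwo` (Prop. 6's regime at `V` = (117)–(121) with [B9] Thm 3.13's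
`B₀`; the data rows; the (20)-smallness; the slot-(c) slice token) plus the radii orderings `ε₄ + a𝔄 ≤ ρ`, `a₃ ≤ ε_C ≤ t₀` (EXISTENTIAL, non-uniform constants).  What is NEW
relative to the (47)-free chart: NOTHING is displayed for the (47) step itself any more — its Lie token, trace row, Sect. C rows, guard and log-disc rows are theorems.
`N = 2` statement.  Nothing of Bałaban's estimates is proved; K0ᴬ ⟨27238⟩ NOT closed; N07 NOT discharged; R4 is the conditional finite-𝕋⁴ rung `BalabanLadder.UV` only;
finite torus at fixed `ε` — nothing continuum ∕ OS ∕ Clay.  **The Yang–Mills mass gap is NOT proved by any of this.**  No `sorry`, no `def`, no `instance ∕ notation`; standard axioms.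
[cite: Balaban1985Variational, (15) p.280, (20) p.281, (44)–(54) pp.285–286, (103) p.293, (109)–(111) p.294, Prop. 6 (115)–(121) p.295; Balaban1987RG1, (0.4) p.253, (0.21) p.256;
Balaban1985BackgroundPropagators, (3.134) p.422]
-/

set_option autoImplicit false

noncomputable section

open scoped Matrix Matrix.Norms.L2Operator InnerProductSpace Topology

namespace Summit.QuantumFields.YangMills.Theorems.N07ChartLinFlatTwoAssembly

open Literature.MathematicalPhysics.QuantumFieldTheory.Balaban1983to89
open Literature.MathematicalPhysics.QuantumFieldTheory.Balaban1983to89.T4Continuum (T4Family)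
open Literature.MathematicalPhysics.QuantumFieldTheory.Balaban1983to89.Node00
open B15AveragingHolomorphic (iterMh)
open B9Eq311TracePairing (starW)
open B11Eq103H1Complex (SiteL2K BondL2K)
open B11Eq111FrakG (nabla115)
open B11Eq115Space (NegSize NegSup JetSup)
open B11Eq174Chart (Regime)
open B11Prop6Scheme (Prop4Hyp)
open B11Eq90V0GroupComposed (T47)
open Summit.QuantumFields.YangMills.Theorems.N07TraceSectorDefs (scalPartW)
open Summit.QuantumFields.YangMills.Theorems.N07LieTokAtOfRecordTwo (lieTokAt_bgSchemeOfRecord_two)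
open Summit.QuantumFields.YangMills.Theorems.N07ChartLinAverageFlat (coeField_chartLinFlat_eq_expOver iter_chartCfgLinFlat_eq exists_radius_rowsFlat)
open Summit.QuantumFields.YangMills.Theorems.N07ChartLinFlatLieTok (realRows_of_lieTokAt expoLinAt_sol_memFlat_of_rows iter_chartCfgLinFlat_eq_of_lieTokAt)
open Summit.QuantumFields.YangMills.Theorems.N07EmapOfRecordTraceSectors (trace_equiv_T47OfRecord_eq_zero_two)
open Summit.QuantumFields.YangMills.Theorems.N07SectCRegimeOfRecordSmall (exists_sectCRegime_ofRecord)
open Summit.QuantumFields.YangMills.Theorems.N07SchemeTokOfRecordTwoSmall (exists_radius_cslRows)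

section Two

variable (F : T4Family) {K : ℕ} (k : ℕ) (Ω : ℕ → Set (Site (F.P K) 0)) (U₀ : GaugeField (F.P K) 0 (SU 2))
  [Fact (0 < (F.L : ℝ))] [Fact (0 < (F.P K).eta k)] (levB : PBond (F.P K) k → ℕ) [Fact (0 < c0Rec F K k)] [Fact (∀ c, 0 < wBRec F K k c)] (a : ℝ)
  (hposb : ∀ x, x ≠ 0 → 0 < RCLike.re ⟪x, laplaceAOfRecord F 2 k U₀ (QOfRecord F 2 k U₀) (QflatOfRecord F 2 k) a x⟫_ℂ)
  (hQ : Function.Surjective (QOfRecord F 2 k U₀))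

/-! ## §1  From the standard row list of the (47)-free chart -/

section Rows

variable {b C₂ c₄ aC εC : ℝ}
  (RC : Regime (H1OfRecordAtBgFlat F 2 K k Ω U₀ levB a hposb hQ) 0 (CslOfRecord F 2 K k Ω U₀ levB) b 0 C₂ c₄ 0 aC εC)
  (hCreal : ∀ A : Space115Lit F 2 K k Ω U₀,
    ((JetSup.equiv _ _ (nabla115 ((F.P K).eta k) (unitsOfRecord F 2 U₀))).symm
        (star (JetSup.equiv _ _ (nabla115 ((F.P K).eta k) (unitsOfRecord F 2 U₀)) A)) : Space115Lit F 2 K k Ω U₀) = A →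
    ‖A‖ ≤ εC + aC → ((NegSup.equiv _ _).symm (star (NegSup.equiv _ _ (CslOfRecord F 2 K k Ω U₀ levB A))) :
      NegSize (F.L : ℝ) ((F.P K).eta k) levB 0 (Matrix (Fin 2) (Fin 2) ℂ)) = CslOfRecord F 2 K k Ω U₀ levB A)
  (hCtr : ∀ A : Space115Lit F 2 K k Ω U₀,
    ((JetSup.equiv _ _ (nabla115 ((F.P K).eta k) (unitsOfRecord F 2 U₀))).symm
        (star (JetSup.equiv _ _ (nabla115 ((F.P K).eta k) (unitsOfRecord F 2 U₀)) A)) : Space115Lit F 2 K k Ω U₀) = A →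
    (∀ b, (JetSup.equiv _ _ (nabla115 ((F.P K).eta k) (unitsOfRecord F 2 U₀)) A b).trace = 0) →
    ‖A‖ ≤ εC + aC → ∀ c, (NegSup.equiv _ _ (CslOfRecord F 2 K k Ω U₀ levB A) c).trace = 0)

include RC hCreal hCtr in
/-- ★★★★ **(rng) ∧ (star_mem)'s AVERAGE CONJUNCT AT ONE FIELD FROM THE STANDARD ROWS** (`N = 2`, frame-free): see the module docstring, §1. -/
theorem iter_chartCfgLinFlat_eq_two (h : SmallBelow (avOfRecord F 2 K) k U₀) (dom : Set (GaugeField (F.P K) k (SU 2)))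
    {Gp : SiteL2K ℂ (F.P K).d (fun _ => (F.P K).sitesPerDir 0) (c0Rec F K k) (WRec 2) →ₗ[ℂ]
      SiteL2K ℂ (F.P K).d (fun _ => (F.P K).sitesPerDir 0) (c0Rec F K k) (WRec 2)}
    {Δ2 : BondL2K ℂ (F.P K).d (fun _ => (F.P K).sitesPerDir 0) (c0Rec F K k) (WRec 2) →ₗ[ℂ]
      BondL2K ℂ (F.P K).d (fun _ => (F.P K).sitesPerDir 0) (c0Rec F K k) (WRec 2)}
    (hposπ : ∀ x, x ≠ 0 → 0 < RCLike.re ⟪x, laplaceAOfRecordAt F 2 k U₀ (hessOpOfRecord128 F 2 k U₀ Gp (QflatOfRecord F 2 k) Δ2)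
      (QOfRecord F 2 k U₀) (QflatOfRecord F 2 k) a x⟫_ℂ) (B₀ C₄ a₃ j a𝔄 ε₄ : ℝ)
    (hGpR : ∀ s, Gp (starW (phiRec 2) s) = starW (phiRec 2) (Gp s)) (hGpS : ∀ s, Gp (scalPartW 2 _ s) = scalPartW 2 _ (Gp s))
    (hΔ2R : ∀ x, Δ2 (starW (phiRec 2) x) = starW (phiRec 2) (Δ2 x)) (hΔ2S : ∀ x, Δ2 (scalPartW 2 _ x) = scalPartW 2 _ (Δ2 x))
    (hP : Prop4Hyp (CslOfRecord F 2 K k Ω U₀ levB) C₂ c₄) (haC : a₃ ≤ aC)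
    (R : Regime (frakGOfRecordAtBg128 F 2 K k Ω U₀ Gp Δ2 a hposπ hQ) (0 : Space115Lit F 2 K k Ω U₀ →L[ℂ] Space115Lit F 2 K k Ω U₀)
      (WOfRecordAt F 2 K k Ω U₀ levB a hposb hQ εC Gp) B₀ 0 C₄ a₃ j a𝔄 ε₄)
    (hJ : ‖JOfRecordAtBg F 2 K k Ω U₀‖ ≤ j) {V : GaugeField (F.P K) k (SU 2)} (h𝔄 : ‖frakAOfRecordAtBg128 F 2 K k Ω U₀ levB Gp Δ2 a hposπ hQ V‖ < a𝔄)
    (h𝔊 : FrakGSliceTok F 2 K k Ω U₀ Gp Δ2 a hposπ hQ)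
    (hV : ∀ c, ‖(V c : Matrix (Fin 2) (Fin 2) ℂ) * star (Averaging.iter (avOfRecord F 2 K) k U₀ c : Matrix (Fin 2) (Fin 2) ℂ) - 1‖ ≤ 1 / 4)
    (hguard : SmallBelow (avOfRecord F 2 K) k ((bgSchemeOfRecord F 2 K k Ω U₀ dom levB Gp Δ2 a hposπ hposb hQ εC B₀ C₄ a₃ j a𝔄 ε₄).chartCfgLin
      (fun _ => T47 (H1OfRecordAtBgFlat F 2 K k Ω U₀ levB a hposb hQ) (CslOfRecord F 2 K k Ω U₀ levB) εC) V))
    (hdiscA : ∀ c, ‖iterMh k (coeField ((bgSchemeOfRecord F 2 K k Ω U₀ dom levB Gp Δ2 a hposπ hposb hQ εC B₀ C₄ a₃ j a𝔄 ε₄).chartCfgLin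
        (fun _ => T47 (H1OfRecordAtBgFlat F 2 K k Ω U₀ levB a hposb hQ) (CslOfRecord F 2 K k Ω U₀ levB) εC) V)) c
        * star (Averaging.iter (avOfRecord F 2 K) k U₀ c : Matrix (Fin 2) (Fin 2) ℂ) - 1‖ < 1) :
    Averaging.iter (avOfRecord F 2 K) k ((bgSchemeOfRecord F 2 K k Ω U₀ dom levB Gp Δ2 a hposπ hposb hQ εC B₀ C₄ a₃ j a𝔄 ε₄).chartCfgLin
      (fun _ => T47 (H1OfRecordAtBgFlat F 2 K k Ω U₀ levB a hposb hQ) (CslOfRecord F 2 K k Ω U₀ levB) εC) V) = V := by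
  have hL := lieTokAt_bgSchemeOfRecord_two F K k Ω U₀ dom levB a hposπ hposb hQ εC B₀ C₄ a₃ j a𝔄 ε₄ RC hCreal hCtr h hGpR hGpS hΔ2R hΔ2S hP haC
    R hJ h𝔄 hV
  have ha : 0 < a𝔄 := (norm_nonneg _).trans_lt h𝔄
  have hfit : ε₄ + a𝔄 ≤ aC := by
    have h1 := R.dom
    have h2 := R.ε₄_nonneg
    linarith
  have hdiscV : V ∈ logDiscOfRecord F 2 K k U₀ :=
    (mem_logDiscOfRecord_iff F 2 K k U₀ V).2 fun c => lt_of_le_of_lt (hV c) (by norm_num)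
  exact iter_chartCfgLinFlat_eq_of_lieTokAt F k Ω U₀ levB a hposb hQ RC hCreal hCtr Gp Δ2 hposπ dom B₀ C₄ a₃ j a𝔄 ε₄ h R hJ h𝔄 h𝔊 hfit hL hguard hdiscA hdiscV

include RC hCreal hCtr in
/-- ★★★★ **THE SAME WITH THE CHART-FIELD GUARD AND THE A-SIDE LOG-DISC ROW DISCHARGED** (`N = 2`, frame-free): one `ρ > 0` from the guarded background and the Sect. C data; all
scheme data and parameters with `ε₄ + a𝔄 ≤ ρ` quantified after it. -/
theorem exists_radius_iter_chartCfgLinFlat_eq_two (h : SmallBelow (avOfRecord F 2 K) k U₀)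
    (hP : Prop4Hyp (CslOfRecord F 2 K k Ω U₀ levB) C₂ c₄) (haC0 : 0 < aC) :
    ∃ ρ : ℝ, 0 < ρ ∧ ρ ≤ aC ∧ ∀ (dom : Set (GaugeField (F.P K) k (SU 2)))
      (Gp : SiteL2K ℂ (F.P K).d (fun _ => (F.P K).sitesPerDir 0) (c0Rec F K k) (WRec 2) →ₗ[ℂ]
        SiteL2K ℂ (F.P K).d (fun _ => (F.P K).sitesPerDir 0) (c0Rec F K k) (WRec 2))
      (Δ2 : BondL2K ℂ (F.P K).d (fun _ => (F.P K).sitesPerDir 0) (c0Rec F K k) (WRec 2) →ₗ[ℂ]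
        BondL2K ℂ (F.P K).d (fun _ => (F.P K).sitesPerDir 0) (c0Rec F K k) (WRec 2))
      (hposπ : ∀ x, x ≠ 0 → 0 < RCLike.re ⟪x, laplaceAOfRecordAt F 2 k U₀ (hessOpOfRecord128 F 2 k U₀ Gp (QflatOfRecord F 2 k) Δ2)
        (QOfRecord F 2 k U₀) (QflatOfRecord F 2 k) a x⟫_ℂ) (B₀ C₄ a₃ j a𝔄 ε₄ : ℝ), ε₄ + a𝔄 ≤ ρ → a₃ ≤ aC →
      (∀ s, Gp (starW (phiRec 2) s) = starW (phiRec 2) (Gp s)) → (∀ s, Gp (scalPartW 2 _ s) = scalPartW 2 _ (Gp s)) →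
      (∀ x, Δ2 (starW (phiRec 2) x) = starW (phiRec 2) (Δ2 x)) → (∀ x, Δ2 (scalPartW 2 _ x) = scalPartW 2 _ (Δ2 x)) →
      Regime (frakGOfRecordAtBg128 F 2 K k Ω U₀ Gp Δ2 a hposπ hQ) (0 : Space115Lit F 2 K k Ω U₀ →L[ℂ] Space115Lit F 2 K k Ω U₀)
        (WOfRecordAt F 2 K k Ω U₀ levB a hposb hQ εC Gp) B₀ 0 C₄ a₃ j a𝔄 ε₄ →
      ‖JOfRecordAtBg F 2 K k Ω U₀‖ ≤ j → FrakGSliceTok F 2 K k Ω U₀ Gp Δ2 a hposπ hQ →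
      ∀ {V : GaugeField (F.P K) k (SU 2)},
      (∀ c, ‖(V c : Matrix (Fin 2) (Fin 2) ℂ) * star (Averaging.iter (avOfRecord F 2 K) k U₀ c : Matrix (Fin 2) (Fin 2) ℂ) - 1‖ ≤ 1 / 4) →
      ‖frakAOfRecordAtBg128 F 2 K k Ω U₀ levB Gp Δ2 a hposπ hQ V‖ < a𝔄 →
      Averaging.iter (avOfRecord F 2 K) k ((bgSchemeOfRecord F 2 K k Ω U₀ dom levB Gp Δ2 a hposπ hposb hQ εC B₀ C₄ a₃ j a𝔄 ε₄).chartCfgLin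
        (fun _ => T47 (H1OfRecordAtBgFlat F 2 K k Ω U₀ levB a hposb hQ) (CslOfRecord F 2 K k Ω U₀ levB) εC) V) = V := by
  obtain ⟨ρ, hρ, hρaC, hrows⟩ := exists_radius_rowsFlat F 2 K k Ω U₀ levB a hposb hQ h RC hP haC0
  refine ⟨ρ, hρ, hρaC, fun dom Gp Δ2 hposπ B₀ C₄ a₃ j a𝔄 ε₄ hfit haC hGpR hGpS hΔ2R hΔ2S R hJ h𝔊 V hV h𝔄 => ?_⟩
  have hL := lieTokAt_bgSchemeOfRecord_two F K k Ω U₀ dom levB a hposπ hposb hQ εC B₀ C₄ a₃ j a𝔄 ε₄ RC hCreal hCtr h hGpR hGpS hΔ2R hΔ2S hP haC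
    R hJ h𝔄 hV
  obtain ⟨hA'herm, hA'tr⟩ := realRows_of_lieTokAt F k Ω U₀ levB a hposb hQ Gp Δ2 hposπ dom B₀ C₄ a₃ j a𝔄 ε₄ (εC := εC) hL
  have hsol := (bgSchemeOfRecord_sol_spec F 2 K k Ω U₀ levB Gp Δ2 a hposπ hposb hQ dom R hJ h𝔄).1
  have hA : ‖(bgSchemeOfRecord F 2 K k Ω U₀ dom levB Gp Δ2 a hposπ hposb hQ εC B₀ C₄ a₃ j a𝔄 ε₄).sol V +
      frakAOfRecordAtBg128 F 2 K k Ω U₀ levB Gp Δ2 a hposπ hQ V‖ < ρ :=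
    lt_of_lt_of_le (lt_of_le_of_lt (norm_add_le _ _) (by linarith)) hfit
  have hn := lt_of_lt_of_le hA hρaC
  have hSU := expoLinAt_sol_memFlat_of_rows F k Ω U₀ levB a hposb hQ RC hCreal hCtr Gp Δ2 hposπ dom B₀ C₄ a₃ j a𝔄 ε₄ h hA'herm hA'tr hn
  obtain ⟨hguard, hdiscA⟩ := hrows _ hA
  have hcoe := coeField_chartLinFlat_eq_expOver F 2 K k Ω U₀ levB a hposb hQ Gp Δ2 hposπ dom V _ hSU
  rw [BgScheme.chartLin_sol] at hcoe
  rw [← hcoe] at hdiscA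
  exact iter_chartCfgLinFlat_eq_two F k Ω U₀ levB a hposb hQ RC hCreal hCtr h dom hposπ B₀ C₄ a₃ j a𝔄 ε₄ hGpR hGpS hΔ2R hΔ2S hP haC R hJ h𝔄 h𝔊 hV
    (hguard _ hcoe) hdiscA

end Rows

/-! ## §2  Every Sect. C row discharged in the small -/

/-- ★★★★★ **(rng) ∧ (star_mem)'s AVERAGE CONJUNCT FOR THE FRAME-FREE (47)-CARRYING CHART, `N = 2`, WITH EVERY SECT. C ROW AND EVERY (47)-SPECIFIC ROW A THEOREM**:
at a background guarded below `k` there is `t₀ > 0` such that for every Sect. C radius `0 < ε_C ≤ t₀` (`a_C := ε_C`) there is `ρ > 0` such that — for all scheme data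
`dom, G′, Δ⁽²⁾, hposπ` and parameters with `ε₄ + a𝔄 ≤ ρ`, `a₃ ≤ ε_C`, the data rows, Prop. 6's regime at `V`, `‖J‖ ≤ j`, the slot-(c) slice token, the (20)-smallness `≤ 1∕4`
and `‖𝔄♭V‖ < a𝔄` — `Averaging.iter (avOfRecord F 2 K) k (𝔖♭.chartCfgLin T♭ V) = V`.  What stays displayed is g27's standard row list for the (47)-FREE chart, verbatim.
[cite: Balaban1985Variational, (15) p.280, (20) p.281, (44)–(54) pp.285–286, Prop. 6 (115)–(121) p.295; Balaban1987RG1, (0.21) p.256; Balaban1985BackgroundPropagators, (3.134) p.422] -/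
theorem exists_iter_chartCfgLinFlat_eq_two_smallRadii (h : SmallBelow (avOfRecord F 2 K) k U₀) :
    ∃ t₀ > 0, ∀ εC : ℝ, 0 < εC → εC ≤ t₀ → ∃ ρ : ℝ, 0 < ρ ∧ ∀ (dom : Set (GaugeField (F.P K) k (SU 2)))
      (Gp : SiteL2K ℂ (F.P K).d (fun _ => (F.P K).sitesPerDir 0) (c0Rec F K k) (WRec 2) →ₗ[ℂ]
        SiteL2K ℂ (F.P K).d (fun _ => (F.P K).sitesPerDir 0) (c0Rec F K k) (WRec 2))
      (Δ2 : BondL2K ℂ (F.P K).d (fun _ => (F.P K).sitesPerDir 0) (c0Rec F K k) (WRec 2) →ₗ[ℂ]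
        BondL2K ℂ (F.P K).d (fun _ => (F.P K).sitesPerDir 0) (c0Rec F K k) (WRec 2))
      (hposπ : ∀ x, x ≠ 0 → 0 < RCLike.re ⟪x, laplaceAOfRecordAt F 2 k U₀ (hessOpOfRecord128 F 2 k U₀ Gp (QflatOfRecord F 2 k) Δ2)
        (QOfRecord F 2 k U₀) (QflatOfRecord F 2 k) a x⟫_ℂ) (B₀ C₄ a₃ j a𝔄 ε₄ : ℝ), ε₄ + a𝔄 ≤ ρ → a₃ ≤ εC →
      (∀ s, Gp (starW (phiRec 2) s) = starW (phiRec 2) (Gp s)) → (∀ s, Gp (scalPartW 2 _ s) = scalPartW 2 _ (Gp s)) →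
      (∀ x, Δ2 (starW (phiRec 2) x) = starW (phiRec 2) (Δ2 x)) → (∀ x, Δ2 (scalPartW 2 _ x) = scalPartW 2 _ (Δ2 x)) →
      Regime (frakGOfRecordAtBg128 F 2 K k Ω U₀ Gp Δ2 a hposπ hQ) (0 : Space115Lit F 2 K k Ω U₀ →L[ℂ] Space115Lit F 2 K k Ω U₀)
        (WOfRecordAt F 2 K k Ω U₀ levB a hposb hQ εC Gp) B₀ 0 C₄ a₃ j a𝔄 ε₄ →
      ‖JOfRecordAtBg F 2 K k Ω U₀‖ ≤ j → FrakGSliceTok F 2 K k Ω U₀ Gp Δ2 a hposπ hQ →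
      ∀ {V : GaugeField (F.P K) k (SU 2)},
      (∀ c, ‖(V c : Matrix (Fin 2) (Fin 2) ℂ) * star (Averaging.iter (avOfRecord F 2 K) k U₀ c : Matrix (Fin 2) (Fin 2) ℂ) - 1‖ ≤ 1 / 4) →
      ‖frakAOfRecordAtBg128 F 2 K k Ω U₀ levB Gp Δ2 a hposπ hQ V‖ < a𝔄 →
      Averaging.iter (avOfRecord F 2 K) k ((bgSchemeOfRecord F 2 K k Ω U₀ dom levB Gp Δ2 a hposπ hposb hQ εC B₀ C₄ a₃ j a𝔄 ε₄).chartCfgLin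
        (fun _ => T47 (H1OfRecordAtBgFlat F 2 K k Ω U₀ levB a hposb hQ) (CslOfRecord F 2 K k Ω U₀ levB) εC) V) = V := by
  obtain ⟨b, C₂, c₄, t₁, -, -, -, ht₁, hP, hReg⟩ := exists_sectCRegime_ofRecord F 2 K k Ω U₀ levB a hposb hQ h
  obtain ⟨r, hr, hcsl⟩ := exists_radius_cslRows F 2 K k Ω U₀ levB h
  refine ⟨min t₁ (r / 3), lt_min ht₁ (by positivity), fun εC hε hεt => ?_⟩
  have hεt₁ : εC ≤ t₁ := hεt.trans (min_le_left _ _)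
  have hεr : εC + εC < r := by
    have := hεt.trans (min_le_right _ _)
    linarith
  have RC : Regime (H1OfRecordAtBgFlat F 2 K k Ω U₀ levB a hposb hQ) 0 (CslOfRecord F 2 K k Ω U₀ levB) b 0 C₂ c₄ 0 εC εC :=
    hReg εC εC hε le_rfl hεt₁
  have hCreal : ∀ A : Space115Lit F 2 K k Ω U₀,
      ((JetSup.equiv _ _ (nabla115 ((F.P K).eta k) (unitsOfRecord F 2 U₀))).symm
          (star (JetSup.equiv _ _ (nabla115 ((F.P K).eta k) (unitsOfRecord F 2 U₀)) A)) : Space115Lit F 2 K k Ω U₀) = A →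
      ‖A‖ ≤ εC + εC → ((NegSup.equiv _ _).symm (star (NegSup.equiv _ _ (CslOfRecord F 2 K k Ω U₀ levB A))) :
        NegSize (F.L : ℝ) ((F.P K).eta k) levB 0 (Matrix (Fin 2) (Fin 2) ℂ)) = CslOfRecord F 2 K k Ω U₀ levB A :=
    fun A hAh hAn => (hcsl A (lt_of_le_of_lt hAn hεr) hAh).1
  have hCtr : ∀ A : Space115Lit F 2 K k Ω U₀,
      ((JetSup.equiv _ _ (nabla115 ((F.P K).eta k) (unitsOfRecord F 2 U₀))).symm
          (star (JetSup.equiv _ _ (nabla115 ((F.P K).eta k) (unitsOfRecord F 2 U₀)) A)) : Space115Lit F 2 K k Ω U₀) = A →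
      (∀ b', (JetSup.equiv _ _ (nabla115 ((F.P K).eta k) (unitsOfRecord F 2 U₀)) A b').trace = 0) →
      ‖A‖ ≤ εC + εC → ∀ c, (NegSup.equiv _ _ (CslOfRecord F 2 K k Ω U₀ levB A) c).trace = 0 :=
    fun A hAh _ hAn => (hcsl A (lt_of_le_of_lt hAn hεr) hAh).2
  obtain ⟨ρ, hρ, -, hfin⟩ := exists_radius_iter_chartCfgLinFlat_eq_two F k Ω U₀ levB a hposb hQ RC hCreal hCtr h hP hε
  exact ⟨ρ, hρ, fun dom Gp Δ2 hposπ B₀ C₄ a₃ j a𝔄 ε₄ hfit ha₃ hGpR hGpS hΔ2R hΔ2S R hJ h𝔊 V hV h𝔄 =>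
    hfin dom Gp Δ2 hposπ B₀ C₄ a₃ j a𝔄 ε₄ hfit ha₃ hGpR hGpS hΔ2R hΔ2S R hJ h𝔊 hV h𝔄⟩

end Two

end Summit.QuantumFields.YangMills.Theorems.N07ChartLinFlatTwoAssembly

end
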